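import Mathlib.AlgebraicTopology.FundamentalGroupoid.SimplyConnected
import Literature.Geometry.Kaehler.Kaehler
import Literature.Geometry.Kaehler.HolomorphicChartForms
import HarnessLib

/-!
# Irreducible (holomorphic) symplectic manifolds = compact hyperkähler manifolds (Beauville)

Layer `Literature/Geometry/Hyperkaehler`. Definition vocabulary requested by `defn-IsOfOGradySixType`
(route HodgeConjecture/OG6CharacterSectors: "compact hyper-Kähler (irreducible holomorphic
symplectic) manifold"). The METRIC notion (a hyperkähler triple `(g, I, J, K)`) is the sibling
file `HyperkaehlerManifold.lean`; this file records the COMPLEX-GEOMETRIC notion used to define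
deformation types (K3⁽ⁿ⁾, Kumₙ, OG6, OG10).

## Sources (read)

* D. Huybrechts, *Compact hyperkähler manifolds: basic results*, Invent. Math. 135 (1999) 63–113
  (arXiv:alg-geom/9705025), §1, Def. 1.1: "A complex manifold `X` is called irreducible symplectic
  if i) `X` is compact and Kähler, ii) `X` is simply connected, and iii) `H⁰(X, Ω²_X)` is spanned by
  an everywhere non-degenerate two-form `σ`." and the lines after it: "Any holomorphic two-form `σ`
  induces a homomorphism `𝒯_X → Ω_X` … The two-form is everywhere non-degenerate if and only if
  `σ : 𝒯_X → Ω_X` is bijective. Note that iii) implies `h^{2,0}(X) = h^{0,2}(X) = 1` and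
  `K_X ≅ 𝒪_X`"; Def. 1.2 and §1.3 (irreducible symplectic ⟺ compact irreducible hyperkähler, via
  Yau's theorem and holonomy).
* A. Beauville, *Variétés kählériennes dont la première classe de Chern est nulle*, J. Differential
  Geom. 18 (1983), §4 ("variétés symplectiques irréductibles"; Prop. 4).
* K. O'Grady, J. Algebraic Geom. 12 (2003), §1: "irreducible symplectic … i.e. simply-connected
  compact Kählerian manifolds carrying a holomorphic symplectic form which spans `H^{2,0}`".

## Rendering (tree carriers)

`M` is a complex manifold charted on the finite-dimensional complex normed space `E`
(`[IsManifold 𝓘(ℂ, E) ω M]`, with its real `C^∞` structure `[IsManifold 𝓘(ℝ, E) ∞ M]` as in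
`Kaehler.lean`, dischargeable by `isManifold_real_of_isManifold_complex`). Complex `k`-forms are
`MForm 𝓘(ℝ, E) M ℂ k` (`Literature/Geometry/Kaehler/ManifoldForms`); holomorphic sections of
`Ω²_M` are the forms `IsHolomorphicInCharts` (`HolomorphicChartForms.lean`, Huybrechts CG
Def. 2.2.14). Then:

* `MForm.IsNondegenerateAt σ x`: the alternating form `σₓ` on `TₓM` has trivial kernel
  (`σₓ(v, ·) = 0 ⟹ v = 0`), i.e. `σ : 𝒯 → Ω` is injective, hence bijective (finite dimension);
* `IsIrreducibleSymplectic E M` (Huybrechts Def. 1.1, verbatim): `M` compact, Kähler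
  (`IsKaehlerManifold E M`: a smooth Kähler metric exists), simply connected
  (`SimplyConnectedSpace M`), and there is a holomorphic `2`-form `σ`, non-degenerate at every
  point, such that every holomorphic `2`-form is a complex multiple of `σ` ("`H⁰(X, Ω²_X)` is
  spanned by `σ`").

Closedness of `σ` is not a clause (it is not one in print): holomorphic forms on compact Kähler
manifolds are closed. Hausdorff/second countability are not clauses either (conventions of the
sources; consumers add `[T2Space M]` etc. as needed).

## API (proved)

The structure projections, `iff`, `connectedSpace`, the
spanning form is non-zero as soon as `M` has a point with a non-zero tangent vector
(`IsNondegenerateAt.ne_zero`), and `IsNondegenerateAt.smul` (non-degeneracy is invariant under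
non-zero scalars, so "spanned by a non-degenerate form" does not depend on the generator).

## Not here

Beauville–Bogomolov form, Fujiki relation, local Torelli, the equivalence with the metric notion
(Huybrechts §1.3; needs Yau's theorem) — cite items against this definition.
-/

noncomputable section

open scoped Manifold ContDiff Topology

/-! ### Non-degenerate two-forms (dot-notation extension of the tree's `MForm`) -/

namespace Literature.Geometry.Kaehler.MForm

variable {E : Type*} [NormedAddCommGroup E] [NormedSpace ℂ E]
  {M : Type*} [TopologicalSpace M] [ChartedSpace E M]

/-- The `2`-form `σ` is **non-degenerate at `x`**: `σₓ(v, w) = 0` for all `w` forces `v = 0`, i.e.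
the induced map `TₓM → TₓM^*`, `v ↦ σₓ(v, ·)` is injective (hence bijective, `TₓM = E` being
finite-dimensional in the intended use): Huybrechts, after Def. 1.1, "everywhere non-degenerate if
and only if `σ : 𝒯_X → Ω_X` is bijective". Deliberate dot-notation extension of the tree's
`Literature.Geometry.Kaehler.MForm` (declared with its absolute name from
`Literature/Geometry/Hyperkaehler`). [cite: Huybrechts1999, §1 Def. 1.1 and the following lines] -/
def IsNondegenerateAt (σ : MForm 𝓘(ℝ, E) M ℂ 2) (x : M) : Prop :=
  ∀ v : TangentSpace 𝓘(ℝ, E) x, (∀ w : TangentSpace 𝓘(ℝ, E) x, σ x ![v, w] = 0) → v = 0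

namespace IsNondegenerateAt

variable {σ : MForm 𝓘(ℝ, E) M ℂ 2} {x : M}

/-- Unfolding. [cite: Huybrechts1999, §1 Def. 1.1] -/
theorem iff : σ.IsNondegenerateAt x ↔
    ∀ v : TangentSpace 𝓘(ℝ, E) x, (∀ w : TangentSpace 𝓘(ℝ, E) x, σ x ![v, w] = 0) → v = 0 :=
  Iff.rfl

/-- A form non-degenerate at a point with a non-zero tangent vector is not the zero form.
[cite: Huybrechts1999, §1 Def. 1.1] -/
theorem ne_zero (h : σ.IsNondegenerateAt x) {v : TangentSpace 𝓘(ℝ, E) x} (hv : v ≠ 0) : σ ≠ 0 := by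
  rintro rfl
  exact hv (h v fun w ↦ rfl)

/-- Non-degeneracy is invariant under non-zero complex scalars. [cite: Huybrechts1999, §1 Def. 1.1] -/
theorem smul (h : σ.IsNondegenerateAt x) {c : ℂ} (hc : c ≠ 0) : (c • σ).IsNondegenerateAt x := by
  intro v hv
  refine h v fun w ↦ ?_
  have hw := hv w
  rw [Pi.smul_apply, ContinuousAlternatingMap.smul_apply, smul_eq_zero] at hw
  exact hw.resolve_left hc

end IsNondegenerateAt

end Literature.Geometry.Kaehler.MForm

namespace Literature.Geometry.Hyperkaehler

open Literature.Geometry.Kaehler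

variable {E : Type*} [NormedAddCommGroup E] [NormedSpace ℂ E]
  {M : Type*} [TopologicalSpace M] [ChartedSpace E M]

/-! ### Irreducible symplectic manifolds -/

variable (E M) in
/-- **Irreducible (holomorphic) symplectic manifold** (Huybrechts 1999, Def. 1.1, verbatim; =
Beauville's "variété symplectique irréductible", = compact irreducible hyperkähler manifold by
Huybrechts §1.3): the complex manifold `M` (charted on `E`) is (i) compact and Kähler, (ii) simply
connected, and (iii) `H⁰(M, Ω²_M)` is spanned by an everywhere non-degenerate two-form: there is
a `2`-form `σ`, holomorphic in charts and non-degenerate at every point, of which every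
holomorphic `2`-form is a complex multiple. The complex-manifold hypotheses (and the real `C^∞`
structure they induce) are instance binders of the declaration, as for `IsKaehlerManifold`.
[cite: Huybrechts1999, §1 Def. 1.1] [cite: Beauville1983, §4] -/
structure IsIrreducibleSymplectic [IsManifold 𝓘(ℝ, E) ∞ M] [FiniteDimensional ℂ E]
    [IsManifold 𝓘(ℂ, E) ω M] : Prop where
  /-- (i) `M` is compact … -/
  compactSpace : CompactSpace M
  /-- … and Kähler. -/
  isKaehlerManifold : IsKaehlerManifold E M
  /-- (ii) `M` is simply connected. -/
  simplyConnectedSpace : SimplyConnectedSpace M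
  /-- (iii) `H⁰(M, Ω²)` is spanned by an everywhere non-degenerate holomorphic `2`-form `σ`. -/
  exists_form : ∃ σ : MForm 𝓘(ℝ, E) M ℂ 2, IsHolomorphicInCharts σ ∧ (∀ x, σ.IsNondegenerateAt x) ∧
    ∀ τ : MForm 𝓘(ℝ, E) M ℂ 2, IsHolomorphicInCharts τ → ∃ c : ℂ, τ = c • σ

namespace IsIrreducibleSymplectic

variable [IsManifold 𝓘(ℝ, E) ∞ M] [FiniteDimensional ℂ E] [IsManifold 𝓘(ℂ, E) ω M]

/-- Unfolding lemma. [cite: Huybrechts1999, §1 Def. 1.1] -/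
theorem iff : IsIrreducibleSymplectic E M ↔ CompactSpace M ∧ IsKaehlerManifold E M ∧
    SimplyConnectedSpace M ∧
      ∃ σ : MForm 𝓘(ℝ, E) M ℂ 2, IsHolomorphicInCharts σ ∧ (∀ x, σ.IsNondegenerateAt x) ∧
        ∀ τ : MForm 𝓘(ℝ, E) M ℂ 2, IsHolomorphicInCharts τ → ∃ c : ℂ, τ = c • σ :=
  ⟨fun h ↦ ⟨h.1, h.2, h.3, h.4⟩, fun h ↦ ⟨h.1, h.2.1, h.2.2.1, h.2.2.2⟩⟩

/-- An irreducible symplectic manifold is connected (it is simply connected).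
[cite: Huybrechts1999, §1 Def. 1.1 (ii)] -/
theorem connectedSpace (h : IsIrreducibleSymplectic E M) : ConnectedSpace M := by
  haveI := h.simplyConnectedSpace
  infer_instance

omit [IsManifold 𝓘(ℝ, E) ∞ M] [FiniteDimensional ℂ E] [IsManifold 𝓘(ℂ, E) ω M] in
/-- Any two spanning forms of an irreducible symplectic manifold with a non-zero tangent vector
somewhere differ by a NON-ZERO scalar (so clause (iii) does not depend on the generator).
[cite: Huybrechts1999, §1 Def. 1.1 (iii)] -/
theorem exists_smul_eq {σ τ : MForm 𝓘(ℝ, E) M ℂ 2}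
    (hσ : ∀ τ' : MForm 𝓘(ℝ, E) M ℂ 2, IsHolomorphicInCharts τ' → ∃ c : ℂ, τ' = c • σ)
    (hτ : IsHolomorphicInCharts τ) {x : M} (hτx : τ.IsNondegenerateAt x)
    {v : TangentSpace 𝓘(ℝ, E) x} (hv : v ≠ 0) : ∃ c : ℂ, c ≠ 0 ∧ τ = c • σ := by
  obtain ⟨c, rfl⟩ := hσ τ hτ
  refine ⟨c, ?_, rfl⟩
  rintro rfl
  exact MForm.IsNondegenerateAt.ne_zero hτx hv (by simp)

end IsIrreducibleSymplectic

end Literature.Geometry.Hyperkaehler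

end
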